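import Summits.RiemannHypothesis.RiemannHypothesis.Theses.RuelleBand

/-!
# `RuelleBand.ZetaWeakRecurrence` — line `Sketch`: the line's SUPPLIER, typed and transferred
(crux stmt-RiemannHypothesis-18110, route route-RiemannHypothesis-RuelleBand)

The idea of line `Sketch` (crux idea `banach-density-invariant-measure`): obtain the late returns of
`ζ(·+iτ)` to `ζ` on a closed disc `D` of the half-strip from ONE shift-invariant Borel probability
measure `ν` on the function space `C(Strip, ℂ)` (`Strip = {1/2 < Re s < 1}`, compact-open topology,
unit vertical shift `g ↦ g(· + i)`) that is carried by the forward orbit closure of `ζ|_Strip` and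
charges the `ε`-sup-neighbourhood of `ζ` on `D` — POINCARÉ RECURRENCE for `ν`, transported back to
the orbit of `ζ` by continuity.

This file lands that transfer in `Theorems/`, with NO new definitions (the shift map and the point
`ζ|_Strip` are quantified and pinned by equations):
* `frequently_mem_of_invariant_charging` — the abstract Poincaré step: `f` continuous, `ν` finite
  `f`-invariant, `ν`-a.e. point in the forward orbit closure of `x₀`, `ν U ≠ 0` for an open `U`
  ⟹ `f^[n] x₀ ∈ U` for unboundedly many `n`;
* `lateReturns_of_invariantMeasure` — (M_{D,ε}) ⟹ late `ε`-returns on `D` (registered sub-goal of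
  the crux; it supplies the open stub `stub_roucheRegime` of `Lines/Sketch.lean` disc by disc).

Honest label: no construction of such a `ν` is known for a disc about a hypothetical off-line zero
(the Bohr–Jessen/Bagchi limit measure gives that neighbourhood mass `0`); and (M_{D,ε}) yields
returns of positive upper Banach density, so as a supplier it sits at WR⁺, above WR.
-/

-- D-0017: single-problem summit; the lakefile turns this linter off for `Summits`; repeated here so that
-- standalone elaboration is warning-free as well.
set_option linter.dupNamespace false

noncomputable section

open Complex Set Metric Filter Topology MeasureTheory

namespace Summit.RiemannHypothesis.RiemannHypothesis.Theorems.RuelleBandZetaWeakRecurrence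

/-! ## 1. The Poincaré step (abstract) -/

/-- **Poincaré step.** `f` continuous, `ν` a finite `f`-invariant Borel measure, `ν`-almost every
point lying in the closure of the forward orbit of `x₀`; if `ν` charges an open set `U`, then the
forward orbit of `x₀` visits `U` at unboundedly many times. (Poincaré recurrence —
`MeasurePreserving.conservative` — gives a point of `U` returning to `U` infinitely often; it is a
limit of orbit points, and continuity of finitely many iterates transports one return to `x₀`.)
[folklore] -/
theorem frequently_mem_of_invariant_charging {X : Type*} [TopologicalSpace X] [MeasurableSpace X]
    [OpensMeasurableSpace X] {f : X → X} (hf : Continuous f) {ν : Measure X} [IsFiniteMeasure ν]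
    (hν : MeasurePreserving f ν ν) {x₀ : X}
    (horb : ∀ᵐ y ∂ν, y ∈ closure (Set.range fun n : ℕ => f^[n] x₀))
    {U : Set X} (hU : IsOpen U) (hpos : ν U ≠ 0) :
    ∃ᶠ n in atTop, f^[n] x₀ ∈ U := by
  have hc : Conservative f ν := hν.conservative
  have hrec := hc.ae_mem_imp_frequently_image_mem hU.measurableSet.nullMeasurableSet
  have hgood : ∀ᵐ y ∂ν, (y ∈ U → ∃ᶠ n in atTop, f^[n] y ∈ U) ∧
      y ∈ closure (Set.range fun n : ℕ => f^[n] x₀) := hrec.and horb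
  have hUG : ν (U ∩ {y | (y ∈ U → ∃ᶠ n in atTop, f^[n] y ∈ U) ∧
      y ∈ closure (Set.range fun n : ℕ => f^[n] x₀)}) ≠ 0 := by
    rwa [measure_inter_conull]
    rw [ae_iff] at hgood
    simpa [Set.compl_def] using hgood
  obtain ⟨y, hyU, hyrec, hycl⟩ := nonempty_of_measure_ne_zero hUG
  have hfreq := hyrec hyU
  rw [Filter.frequently_atTop] at hfreq ⊢
  intro N
  obtain ⟨n, hnN, hn⟩ := hfreq N
  have hVopen : IsOpen ((f^[n]) ⁻¹' U) := hU.preimage (hf.iterate n)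
  obtain ⟨w, hwV, ⟨m, rfl⟩⟩ := mem_closure_iff.1 hycl _ hVopen hn
  refine ⟨n + m, by omega, ?_⟩
  rw [Function.iterate_add_apply]
  exact hwV

/-! ## 2. The transfer on `C(Strip, ℂ)` -/

/-- Iterating precomposition: `(· ∘ Φ)^[n] g = g ∘ Φ^[n]`. -/
theorem comp_iterate_apply {α : Type*} [TopologicalSpace α] (Φ : C(α, α)) (g : C(α, ℂ)) (n : ℕ)
    (s : α) : ((fun h : C(α, ℂ) => h.comp Φ)^[n] g) s = g (Φ^[n] s) := by
  induction n generalizing s with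
  | zero => rfl
  | succ n ih =>
    rw [Function.iterate_succ_apply', Function.iterate_succ_apply]
    exact ih (Φ s)

/-- Iterating the unit vertical shift on the strip: `Φ^[n] s = s + n·i`. -/
theorem coe_iterate_of_shift {S : Set ℂ} (Φ : C(S, S)) (hΦ : ∀ s : S, ((Φ s : S) : ℂ) = (s : ℂ) + I)
    (n : ℕ) (s : S) : ((Φ^[n] s : S) : ℂ) = (s : ℂ) + n * I := by
  induction n generalizing s with
  | zero => simp
  | succ n ih =>
    rw [Function.iterate_succ_apply', hΦ, ih]
    push_cast; ring

/-- A closed disc `|s − z| ≤ r` with `r < min (Re z − 1/2, 1 − Re z)` lies in the open half-strip. -/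
theorem closedBall_subset_halfStrip {z : ℂ} {r : ℝ} (hrmin : r < min (z.re - 1 / 2) (1 - z.re)) :
    Metric.closedBall z r ⊆ {s : ℂ | 1 / 2 < s.re ∧ s.re < 1} := by
  intro s hs
  rw [mem_closedBall, dist_eq_norm] at hs
  have h := (abs_re_le_norm (s - z)).trans hs
  rw [sub_re, abs_le] at h
  have hr1 : r < z.re - 1 / 2 := hrmin.trans_le (min_le_left _ _)
  have hr2 : r < 1 - z.re := hrmin.trans_le (min_le_right _ _)
  exact ⟨by linarith [h.1], by linarith [h.2]⟩

/-- **(M_{D,ε}) ⟹ late returns** — the line's supplier, transferred (registered sub-goal of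
stmt-RiemannHypothesis-18110). On the function space `C(Strip, ℂ)` (`Strip = {1/2 < Re s < 1}`,
compact-open topology) let `Φ` be the unit vertical shift of the strip and `ζS = ζ|_Strip`. If a Borel
probability measure `ν`, invariant under `g ↦ g ∘ Φ` and carried by the forward orbit closure of
`ζS`, charges the set of `g` that are `ε`-close to `ζ` on the closed disc `|s − z| ≤ r`, then beyond
every height `T` some (integer) shift `τ ≥ T` has `max_{|s−z|≤r} |ζ(s+iτ) − ζ(s)| < ε`. (The charged
set is open — restriction to the compact disc is continuous into the sup-metric space — so the
Poincaré step applies; `(· ∘ Φ)^[n] ζS = ζ(· + n i)`.) [folklore] -/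
theorem lateReturns_of_invariantMeasure :
    ∀ [MeasurableSpace C(↥{s : ℂ | 1 / 2 < s.re ∧ s.re < 1}, ℂ)]
      [BorelSpace C(↥{s : ℂ | 1 / 2 < s.re ∧ s.re < 1}, ℂ)] (z : ℂ) (r : ℝ), 0 < r →
      r < min (z.re - 1 / 2) (1 - z.re) → ∀ ε : ℝ, 0 < ε →
      (∃ (Φ : C(↥{s : ℂ | 1 / 2 < s.re ∧ s.re < 1}, ↥{s : ℂ | 1 / 2 < s.re ∧ s.re < 1}))
        (ζS : C(↥{s : ℂ | 1 / 2 < s.re ∧ s.re < 1}, ℂ))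
        (ν : MeasureTheory.Measure C(↥{s : ℂ | 1 / 2 < s.re ∧ s.re < 1}, ℂ)),
        (∀ s : ↥{s : ℂ | 1 / 2 < s.re ∧ s.re < 1}, ((Φ s : ↥{s : ℂ | 1 / 2 < s.re ∧ s.re < 1}) : ℂ)
            = (s : ℂ) + Complex.I) ∧
        (∀ s : ↥{s : ℂ | 1 / 2 < s.re ∧ s.re < 1}, ζS s = riemannZeta s) ∧
        MeasureTheory.IsProbabilityMeasure ν ∧
        MeasureTheory.MeasurePreserving (fun g => g.comp Φ) ν ν ∧
        (∀ᵐ g ∂ν, g ∈ closure (Set.range fun n : ℕ => (fun g => g.comp Φ)^[n] ζS)) ∧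
        0 < ν {g | ∀ s : ↥{s : ℂ | 1 / 2 < s.re ∧ s.re < 1}, (s : ℂ) ∈ Metric.closedBall z r →
            ‖g s - riemannZeta s‖ < ε}) →
      ∀ T : ℝ, ∃ τ : ℝ, T ≤ τ ∧
        ∀ s ∈ Metric.closedBall z r, ‖riemannZeta (s + ↑τ * Complex.I) - riemannZeta s‖ < ε := by
  intro _ _ z r hr hrmin ε _ hM T
  obtain ⟨Φ, ζS, ν, hΦ, hζS, hprob, hν, horb, hpos⟩ := hM
  have hKS : Metric.closedBall z r ⊆ {s : ℂ | 1 / 2 < s.re ∧ s.re < 1} := closedBall_subset_halfStrip hrmin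
  -- the disc as a compact, nonempty subset of the strip
  set K : Set {s : ℂ | 1 / 2 < s.re ∧ s.re < 1} := Subtype.val ⁻¹' Metric.closedBall z r with hK
  have hKc : IsCompact K := by
    rw [Subtype.isCompact_iff]
    have himg : Subtype.val '' K = Metric.closedBall z r := by
      rw [hK, Subtype.image_preimage_coe, inter_eq_right.2 hKS]
    rw [himg]
    exact isCompact_closedBall z r
  haveI : CompactSpace K := isCompact_iff_compactSpace.1 hKc
  haveI : Nonempty K :=
    ⟨⟨⟨z, hKS (mem_closedBall_self hr.le)⟩, by simp [hK, mem_closedBall_self hr.le]⟩⟩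
  -- the charged set is open (compact-open topology)
  set U : Set C({s : ℂ | 1 / 2 < s.re ∧ s.re < 1}, ℂ) :=
    {g | ∀ s : {s : ℂ | 1 / 2 < s.re ∧ s.re < 1}, (s : ℂ) ∈ Metric.closedBall z r → ‖g s - riemannZeta s‖ < ε} with hU
  have hUeq : U = (fun g : C({s : ℂ | 1 / 2 < s.re ∧ s.re < 1}, ℂ) => g.restrict K) ⁻¹' Metric.ball (ζS.restrict K) ε := by
    ext g
    simp only [hU, Set.mem_setOf_eq, Set.mem_preimage, Metric.mem_ball]
    rw [ContinuousMap.dist_lt_iff_of_nonempty]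
    constructor
    · intro h k
      have hk : ((k : {s : ℂ | 1 / 2 < s.re ∧ s.re < 1}) : ℂ) ∈ Metric.closedBall z r := k.2
      have h1 := h k hk
      rw [← hζS] at h1
      rw [dist_eq_norm]
      exact h1
    · intro h s hs
      have h1 := h ⟨s, hs⟩
      rw [dist_eq_norm] at h1
      have h2 : ‖g s - ζS s‖ < ε := h1
      rwa [hζS] at h2
  have hUopen : IsOpen U := by
    rw [hUeq]
    exact Metric.isOpen_ball.preimage (ContinuousMap.continuous_restrict K)
  -- Poincaré step, then read off a late integer return
  haveI := hprob
  have hfreq := frequently_mem_of_invariant_charging (ContinuousMap.continuous_precomp Φ) hν horb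
    hUopen hpos.ne'
  obtain ⟨n, hn, hnU⟩ := Filter.frequently_atTop.1 hfreq ⌈T⌉₊
  refine ⟨n, (Nat.le_ceil T).trans (by exact_mod_cast hn), fun s hs => ?_⟩
  have hsS : s ∈ {s : ℂ | 1 / 2 < s.re ∧ s.re < 1} := hKS hs
  have key : ((fun g : C({s : ℂ | 1 / 2 < s.re ∧ s.re < 1}, ℂ) => g.comp Φ)^[n] ζS) ⟨s, hsS⟩ =
      riemannZeta (s + (n : ℂ) * I) := by
    rw [comp_iterate_apply, hζS, coe_iterate_of_shift Φ hΦ]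
  have h1 := hnU ⟨s, hsS⟩ hs
  rw [key] at h1
  have h2 : ((n : ℝ) : ℂ) = (n : ℂ) := Complex.ofReal_natCast n
  rw [h2]
  exact h1

end Summit.RiemannHypothesis.RiemannHypothesis.Theorems.RuelleBandZetaWeakRecurrence

end
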